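import Literature.AlgebraicGeometry.Resolution.NearPointRidgeDietel
import Summits.ResolutionOfSingularities.ResolutionOfSingularities.Theorems.HilbertSamuelEliminationCampaignW42NearAlignment
import Literature.AlgebraicGeometry.Resolution.QuasiExcellentSchemes
import Literature.AlgebraicGeometry.Resolution.DirectrixScheme
import Literature.AlgebraicGeometry.Resolution.BlowupReducedDimension
import Literature.AlgebraicGeometry.Resolution.BlowupsProperProofs
import Literature.AlgebraicGeometry.Resolution.PointBlowupHsFunMono
import Mathlib.RingTheory.AlgebraicIndependent.Transcendental
import HarnessLib

/-!
# [OURS · L1 W4.2] The W-TOP CONFINEMENT DOOR: at a point with `ē_x(X) = dim X ≤ 5` a closed NEAR point of the point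
# blow-up that keeps `ē` lies on `ℙ(Dir_x(X))` — every positive characteristic, every residue field (modulo Dietel 2015
# Main Theorem C, Lemma (6.3.5) (ii), and the near-alignment lemma, all BY NAME)
# (cell res-hironaka, LADDER-RESOLUTION rung L; slot W4.2, crux chain w42 `SigmaMaxModificationsCorridor3`
# stmt-ResolutionOfSingularities-19249; W4.2 DEAL res-L1-w42-plan-1 2026-08-27T07:34:07Z, object **D10 «(b3) W-TOP
# CONFINEMENT AT p = 2»**, hand res-D-pv-047 AS res-L1-s46-pv-10; `--supports stmt-ResolutionOfSingularities-19249 --as helper`)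

HONEST FRAMING. Everything here is OURS (campaign architecture of slot W4.2 over the tree's published-mathematics library);
NOTHING is a statement of H. Hironaka's manuscript [Hironaka2017]; no `Theses/…` import. The printed inputs enter BY NAME
ONLY, as hypotheses: `Dietel2015_mainTheoremC_point_locus` (F-58♭, `Literature/…/NearPointRidgeDietel.lean`, THESIS-flagged
source, res-lit-4 p509086) and `Dietel2015_ridge_perfect` (F-56, ibid.); and the OURS placeholder `CampaignW42.NearAlignment`
(§0 below) = the STATEMENT of res-L1-type-o1's alignment lemma (AL), CJS 2020 Thm. 3.10 (2) «⇒»,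
to be PROVED by its holder — every consumer then discharges it in one line. AI-written; AI review is weaker than expert
review.

## The mathematics (why the ridge clause of Main Theorem C is automatic «at the top»)

Dietel's Main Theorem C (point centre, locus form F-58♭): blow up a locally noetherian `X` in a closed point `x` with
`char κ(x) = p > 0`; if `x' ∈ π⁻¹(x)` keeps the Hilbert series (`H^{(d+1)}[𝒪_{X',x'}] = H^{(1)}[𝒪_{X,x}]`,
`d = tr.deg κ(x')/κ(x)`) AND the ridge dimension (`dim F_{x'}(X') + d = dim F_x(X)`), and `dim X ≤ 5` or
`dim X + 1 ≤ 2p`, then `x' ∈ ℙ(Dir_x(X))` (`CossartJannsenSaito2020.IsOnProjDirectrix π x'`). In the W-TOP rows of the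
w42 ladder (`ē_x(X) = 3 = dim X`, CLOSED near points `x'` with `ē_{x'}(X') ≥ 3`) both side conditions come for free:

* `d = 0`: a closed point of the blow-up has residue field FINITE over `κ(x)` (blow-ups are proper, hence locally of
  finite type; Stacks 01TB, tree `finite_residueFieldMap_of_isClosed`), so `tr.deg = 0`
  (`trdeg_residueField_eq_zero_of_isClosed`);
* the ridge clause: by F-56 (Dietel Lemma (6.3.5) (ii) with `K = κ(x)^{alg}`, perfect) the ridge dimension of ANY
  noetherian local ring equals its geometric directrix dimension, `dim F_x(X) = ē_x(X)`
  (`ridgeDim_eq_geomDirDim_of_ridge_perfect`); and `ē_{x'}(X') ≤ dim 𝒪_{X',x'} ≤ dim 𝒪_{X,x} ≤ dim X`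
  (CJS Def. 2.21 `Scheme.natCast_geomDirDim_le_ringKrullDim_stalk`; Matsumura 15.5 for blow-ups,
  `IsBlowup.ringKrullDim_stalk_le_of_isLocallyNoetherian`; `dim 𝒪_{X,x} ≤ dim X`), so `ē_x = n ≥ dim X` and
  `n ≤ ē_{x'}` force `dim F_{x'}(X') = ē_{x'} = n = ē_x = dim F_x(X)` (`geomDirDim_le_of_isBlowup_of_topologicalKrullDim_le`);
* permissibility of the centre `{x}` (CJS Def. 3.1: `𝔪_x` not a minimal prime) follows from `dim 𝒪_{X,x} ≥ ē_x = n ≥ 1`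
  (`isPermissible_vanishingIdeal_singleton_of_ringKrullDim_pos`).

Hence **`isOnProjDirectrix_of_hilbertSamuelFun_eq_top`** (Dietel-near form, hypotheses F-58♭ + F-56) and, composing with
`NearAlignment` (CJS-near `H^N_{X'}(x') = H^N_X(x)` ⟹ Dietel-near), the DEAL-shaped door
**`isOnProjDirectrix_of_near_top`** (any `n` with `dim X ≤ n = ē_x`, `n ≤ ē_{x'}`, `n ≤ 5 ∨ n + 1 ≤ 2·char κ(x)`) and its
threefold instance **`isOnProjDirectrix_of_near_wtop`** (`n = 3`: NO side condition, EVERY `p > 0` — at `p ≥ 3` this is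
also CJS Thm. 3.14 via `CharHypothesis`, `CossartJannsenSaito2020.Thm314_point_locus`; the content is `p = 2`, where
Thm. 3.14's standing hypothesis (F1) fails in dimension three and near points CAN leave `ℙ(Dir)` when `ē` drops — the
W-top rows are exactly the steps where it does not drop). Consumers (W4.2 DEAL): the W-top laws at `p = 2` (res-type-067
G6 door, C4/T3 vertex–translation dichotomy, D9 births row). VACUITY: the doors are not vacuous — W-top closed near
points exist (e.g. the origin of `y² + x³z³w³…`-type threefold hypersurfaces over `𝔽₂` blown up at a point: the
strict transform meets `ℙ(Dir) ≅ ℙ²` in near points with `ē = 3` again, bench families of L/w42/CRUX-PLAN.md §E5); if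
`dim X < n` the hypothesis `ē_x = n` is impossible and the statement is void there (harmless).

## Not here

The alignment lemma (AL) itself (held by res-L1-type-o1; plan of record in the docstring of `NearAlignment`); the locus form for
arbitrary permissible centres `D` (needs `ℙ(Dir(C_{X,x}/T_{D,x})) ⊂ π⁻¹(x)` in the tree — TODO of F-58♭); any discharge
of F-56/F-58 (Dietel's Ch. 10 via Oda's classification of Hironaka schemes; [H4] Th. IV).

## References

* B. Dietel, Dissertation Regensburg (2014/2015), Main Theorem C p. 130, §10.5 p. 129, Thm. (8.2.7) p. 105,
  Lemma (6.3.5) (ii) p. 76. [Dietel2015]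
* V. Cossart, U. Jannsen, S. Saito, LNM 2270 (2020), Def. 2.21, Def. 2.28, Def. 3.1, Thm. 3.10, Thm. 3.14,
  Def. 6.34 (i), Rem. 18.29. [CossartJannsenSaito2020]
* H. Matsumura, *Commutative Ring Theory*, Thm. 15.5. [Matsumura1987]
* The Stacks Project, Tag 01TB. [StacksProject]
-/

noncomputable section

set_option linter.dupNamespace false -- mandated namespace of this single-conjunct summit

open CategoryTheory AlgebraicGeometry TopologicalSpace IsLocalRing
open Literature.RingTheory.HilbertSamuel Literature.AlgebraicGeometry.Resolution
open Literature.AlgebraicGeometry.CossartJannsenSaito2020 (IsOnProjDirectrix)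

namespace Summit.ResolutionOfSingularities.ResolutionOfSingularities.Theorems

namespace CampaignW42

universe u

/-! ## 0. `NearAlignment` — the statement of the alignment lemma (AL), carried BY NAME -/

/-- [OURS · L1 W4.2] **`NearAlignment`** — the STATEMENT of the (NEAR) alignment lemma (AL) of res-L1-type-o1's bridge
object (to land as `IsBlowup.exists_trdeg_hilbertSamuelFun_eq_of_hsFun_eq`), carried BY NAME as a hypothesis of the
W-top confinement door until then (W4.2 DEAL 2026-08-27T07:34:07Z, D10). For `X` excellent and locally noetherian, `D`
a permissible centre (CJS Def. 3.1), `π : X' → X` a blow-up along `D`, `N ≥ dim X`, and a point `x'` of `X'` over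
`V(D)` that is NEAR at level `N` (`H^N_{X'}(x') = H^N_X(π x')`, `Scheme.hsFun`): there is a natural number `d` with
`tr.deg(κ(x')/κ(π x')) = d` (`Algebra.trdeg` for `residueAlgebraOfHom π x'`) and
`H^{(d+1)}[𝒪_{X',x'}] = H^{(1)}[𝒪_{X,π x'}]` (`hilbertSamuelFun`) — the «⇒» half of CJS 2020 Thm. 3.10 (2) after one
partial summation, i.e. exactly the hypothesis "(8.2.7.A) is an equality" of Dietel's F-54/F-58/F-58♭. Hypothesis list
= that of the tree's `CossartJannsenSaito2020_thm_3_10_4`. A CAMPAIGN PLACEHOLDER (published mathematics, to be PROVED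
in the tree by the holder of (AL); nothing is asserted here); NOT a statement of the manuscript [Hironaka2017].
PLAN OF RECORD for its proof (res-L1-w42-plan-1 DEAL D10; route res-D-pv-047 / res-type-004 2026-08-27T07:23–07:24Z):
squeeze the chain form of CJS Thm. 3.10 (1) in the tree (`hilbertSamuelFun_add_length_le_of_isPermissible` for EVERY
chain of primes above `P` in the chart, `exists_ltSeries_minimalPrimesCodim_le` for one chain) to equalities under the
near hypothesis by strict index-monotonicity of `H^{(·)}` (`hilbertFun_zero`) and injectivity of partial summation
(`iterPSum_injective`); the chain is then of maximal length `dim C/P = tr.deg_{κ(x)} κ(x')`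
(`Literature.RingTheory.KrullDimension.ringKrullDim_eq_trdeg`, `κ(x') = Frac(C/P)`), no general dimension formula
needed. Deliberately an UNTAGGED parameterless `Prop` so that the gate keeps it in this campaign file (precedent
`…Corridor3WLadderBirthDefs.lean` p505417 `BirthTidy`). VACUITY: not vacuous (near points of permissible blow-ups
exist, e.g. over the origin of the Whitney umbrella); at a closed near point `d = 0` and the conclusion is
`H^{(1)}[𝒪_{X',x'}] = H^{(1)}[𝒪_{X,π x'}]`. -/
def NearAlignment : Prop :=
  ∀ (X X' : Scheme.{u}) [IsLocallyNoetherian X] [IsLocallyNoetherian X'] (π : X' ⟶ X)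
    (D : X.IdealSheafData),
    Scheme.IsExcellent X → IdealSheafData.IsPermissible D → IsBlowup π D →
      ∀ N : ℕ, topologicalKrullDim X ≤ (N : WithBot ℕ∞) →
        ∀ x' : X', π.base x' ∈ (D.support : Set X) →
          Scheme.hsFun X' N x' = Scheme.hsFun X N (π.base x') →
            ∃ d : ℕ,
              @Algebra.trdeg (X.residueField (π.base x')) (X'.residueField x') _ _
                  (residueAlgebraOfHom π x') = (d : Cardinal.{u}) ∧
                hilbertSamuelFun (X'.presheaf.stalk x') (d + 1) =
                  hilbertSamuelFun (X.presheaf.stalk (π.base x')) 1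

/-! ## 1. Under F-56 the ridge dimension is the geometric directrix dimension, at every point -/

section Ridge

variable {X : Scheme.{u}} [IsLocallyNoetherian X]

/-- [OURS · L1 W4.2] **`dim F_x(X) = ē_x(X)` at EVERY point of a locally noetherian scheme, modulo F-56** (Dietel 2015
Lemma (6.3.5) (ii) `dim Rid(C) = dim Dir(C_K)` for `K` perfect, applied to the tangent cone `C = C_x(X)` over `k = κ(x)`
with `K` an algebraic closure of `κ(x)` — over which `dim Dir(C_K) = ē_x(X)` is CJS Def. 2.21, tree `Scheme.geomDirDim`).
[cite: Dietel2015, Lemma (6.3.5) (ii) p. 76] -/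
theorem ridgeDim_eq_geomDirDim_of_ridge_perfect (h56 : Dietel2015_ridge_perfect.{u}) (x : X) :
    Scheme.ridgeDim X x = Scheme.geomDirDim X x := by
  rw [Scheme.ridgeDim_eq, localRidgeDim_eq]
  have hJ : IsHomogeneousIdeal (canonicalTangentConeIdeal (X.presheaf.stalk x)) :=
    isHomogeneousIdeal_tangentConeIdeal (minGenerators (X.presheaf.stalk x))
      (span_range_minGenerators (X.presheaf.stalk x))
  exact (h56 (ResidueField (X.presheaf.stalk x)) _ (canonicalTangentConeIdeal (X.presheaf.stalk x)) hJ
    (AlgebraicClosure (ResidueField (X.presheaf.stalk x))) inferInstance).2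

end Ridge

/-! ## 2. Elementary bounds at points of a blow-up -/

section Bounds

variable {X X' : Scheme.{u}} [IsLocallyNoetherian X] [IsLocallyNoetherian X'] {π : X' ⟶ X}

omit [IsLocallyNoetherian X] in
/-- `dim 𝒪_{X,x} ≤ dim X` in the form `≤ n`. [folklore] -/
theorem ringKrullDim_stalk_le_of_topologicalKrullDim_le {n : ℕ} (hdim : topologicalKrullDim X ≤ (n : WithBot ℕ∞))
    (x : X) : ringKrullDim (X.presheaf.stalk x) ≤ (n : WithBot ℕ∞) := by
  rw [ringKrullDim_stalk_eq_coheight]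
  exact_mod_cast (topologicalKrullDim_le_iff_forall_coheight_le X n).mp hdim x

/-- [OURS · L1 W4.2] **`ē_{x'}(X') ≤ dim X` at every point of a blow-up of `X`**: `ē_{x'}(X') ≤ dim 𝒪_{X',x'}` (CJS
Def. 2.21) `≤ dim 𝒪_{X,π x'}` (blowing up does not raise the dimension of the local rings, Matsumura 15.5) `≤ dim X`.
[cite: CossartJannsenSaito2020, Def. 2.21] [cite: Matsumura1987, Thm. 15.5] -/
theorem geomDirDim_le_of_isBlowup_of_topologicalKrullDim_le {D : X.IdealSheafData} (hπ : IsBlowup π D) {n : ℕ}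
    (hdim : topologicalKrullDim X ≤ (n : WithBot ℕ∞)) (x' : X') : Scheme.geomDirDim X' x' ≤ n := by
  have h1 := Scheme.natCast_geomDirDim_le_ringKrullDim_stalk (X := X') x'
  have h2 := hπ.ringKrullDim_stalk_le_of_isLocallyNoetherian x'
  have h3 := ringKrullDim_stalk_le_of_topologicalKrullDim_le hdim (π.base x')
  have h : (Scheme.geomDirDim X' x' : WithBot ℕ∞) ≤ (n : WithBot ℕ∞) := h1.trans (h2.trans h3)
  exact_mod_cast h

omit [IsLocallyNoetherian X] in
/-- [OURS · L1 W4.2] **A closed point `x` with `dim 𝒪_{X,x} > 0`, with its reduced structure, is a permissible centre**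
(CJS Def. 3.1 (2): for `V(𝔪_x) = {x}` the only condition with content is «`{x}` is not an irreducible component», i.e.
`𝔪_x` is not a minimal prime, tree `isPermissible_vanishingIdeal_singleton_iff`; a minimal `𝔪_x` has height `0 = dim 𝒪_{X,x}`).
[cite: CossartJannsenSaito2020, Def. 3.1 (2)] -/
theorem isPermissible_vanishingIdeal_singleton_of_ringKrullDim_pos {x : X} (hx : IsClosed ({x} : Set X))
    (hpos : 0 < ringKrullDim (X.presheaf.stalk x)) :
    IdealSheafData.IsPermissible (Scheme.IdealSheafData.vanishingIdeal ⟨{x}, hx⟩) := by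
  rw [isPermissible_vanishingIdeal_singleton_iff hx]
  intro hmin
  have h0 : (maximalIdeal (X.presheaf.stalk x)).height = 0 := Ideal.height_eq_zero_iff.mpr hmin
  have hdim : ringKrullDim (X.presheaf.stalk x) = 0 := by
    rw [← IsLocalRing.maximalIdeal_height_eq_ringKrullDim, h0]
    rfl
  rw [hdim] at hpos
  exact lt_irrefl _ hpos

omit [IsLocallyNoetherian X] [IsLocallyNoetherian X'] in
/-- [OURS · L1 W4.2] **At a CLOSED point of the source of a morphism locally of finite type the residue field extension has
transcendence degree `0`** (`κ(x')` is finite over `κ(π x')`, Stacks 01TB, tree `finite_residueFieldMap_of_isClosed`; a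
finite, hence algebraic, extension has `tr.deg = 0`). Read with the explicit algebra structure `residueAlgebraOfHom π x'`
of F-54/F-58/F-58♭. [cite: StacksProject, Tag 01TB] -/
theorem trdeg_residueField_eq_zero_of_isClosed (π : X' ⟶ X) [LocallyOfFiniteType π] {x' : X'}
    (hcl : IsClosed ({x'} : Set X')) :
    @Algebra.trdeg (X.residueField (π.base x')) (X'.residueField x') _ _ (residueAlgebraOfHom π x') = 0 := by
  letI : Algebra (X.residueField (π.base x')) (X'.residueField x') := residueAlgebraOfHom π x'
  haveI : Module.Finite (X.residueField (π.base x')) (X'.residueField x') :=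
    finite_residueFieldMap_of_isClosed π hcl
  haveI : Algebra.IsAlgebraic (X.residueField (π.base x')) (X'.residueField x') :=
    Algebra.IsAlgebraic.of_finite _ _
  exact trdeg_eq_zero

end Bounds

/-! ## 3. The doors -/

section Doors

variable {X X' : Scheme.{u}} [IsLocallyNoetherian X] [IsLocallyNoetherian X'] {π : X' ⟶ X} {x : X}

/-- [OURS · L1 W4.2] **TOP CONFINEMENT, Dietel-near form.** Let `X` be locally noetherian with `dim X ≤ n`, `x` a closed
point with `char κ(x) > 0` and `ē_x(X) = n` («at the top»: then `dim 𝒪_{X,x} = n`), `π : X' → X` the blow-up in `{x}`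
(reduced), and `x'` a CLOSED point over `x` with `ē_{x'}(X') ≥ n` which keeps the Hilbert–Samuel function,
`H^{(1)}[𝒪_{X',x'}] = H^{(1)}[𝒪_{X,x}]`; assume `n ≤ 5` or `n + 1 ≤ 2·char κ(x)`. Then `x' ∈ ℙ(Dir_x(X))`
(`IsOnProjDirectrix π x'`). Modulo F-58♭ (Dietel Main Theorem C, point centre, locus form) and F-56 (Lemma (6.3.5) (ii)),
BY NAME: `d = tr.deg κ(x')/κ(x) = 0` at the closed point, the centre is permissible as `dim 𝒪_{X,x} ≥ ē_x = n ≥ 1`, and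
the ridge clause `dim F_{x'}(X') = dim F_x(X)` holds because both equal `ē = n` (§1–§2). NOT a statement of the manuscript.
[cite: Dietel2015, Main Theorem C p. 130; Lemma (6.3.5) (ii) p. 76] -/
theorem isOnProjDirectrix_of_hilbertSamuelFun_eq_top (h58 : Dietel2015_mainTheoremC_point_locus.{u})
    (h56 : Dietel2015_ridge_perfect.{u}) (hx : IsClosed ({x} : Set X))
    (hπ : IsBlowup π (Scheme.IdealSheafData.vanishingIdeal ⟨{x}, hx⟩)) {n : ℕ} (hn : 1 ≤ n)
    (hdim : topologicalKrullDim X ≤ (n : WithBot ℕ∞))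
    (hC : n ≤ 5 ∨ n + 1 ≤ 2 * ringChar (X.residueField x)) (hchar : 0 < ringChar (X.residueField x))
    {x' : X'} (hxx' : π.base x' = x) (hcl : IsClosed ({x'} : Set X'))
    (htop : Scheme.geomDirDim X x = n) (htop' : n ≤ Scheme.geomDirDim X' x')
    (hH : hilbertSamuelFun (X'.presheaf.stalk x') 1 = hilbertSamuelFun (X.presheaf.stalk x) 1) :
    IsOnProjDirectrix π x' := by
  subst hxx'
  haveI : IsProper π := hπ.isProper
  -- `dim 𝒪_{X,x} ≥ ē_x = n ≥ 1`: the centre `{x}` is permissible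
  have hē : (n : WithBot ℕ∞) ≤ ringKrullDim (X.presheaf.stalk (π.base x')) := by
    have h := Scheme.natCast_geomDirDim_le_ringKrullDim_stalk (X := X) (π.base x')
    rwa [htop] at h
  have hpos : 0 < ringKrullDim (X.presheaf.stalk (π.base x')) :=
    lt_of_lt_of_le (by exact_mod_cast hn) hē
  have hperm := isPermissible_vanishingIdeal_singleton_of_ringKrullDim_pos hx hpos
  -- `d = 0`
  have htr := trdeg_residueField_eq_zero_of_isClosed π hcl
  -- the ridge clause: `dim F_{x'}(X') = ē_{x'}(X') = n = ē_x(X) = dim F_x(X)`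
  have hē' : Scheme.geomDirDim X' x' = n :=
    le_antisymm (geomDirDim_le_of_isBlowup_of_topologicalKrullDim_le hπ hdim x') htop'
  have hridge : Scheme.ridgeDim X' x' + 0 = Scheme.ridgeDim X (π.base x') := by
    rw [add_zero, ridgeDim_eq_geomDirDim_of_ridge_perfect h56, ridgeDim_eq_geomDirDim_of_ridge_perfect h56,
      hē', htop]
  -- the dimension side condition of Main Theorem C
  have hC' : topologicalKrullDim X ≤ (5 : WithBot ℕ∞) ∨
      topologicalKrullDim X + 1 ≤ (((2 * ringChar (X.residueField (π.base x')) : ℕ)) : WithBot ℕ∞) := by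
    rcases hC with h5 | h2p
    · left
      exact hdim.trans (by exact_mod_cast h5)
    · right
      calc topologicalKrullDim X + 1 ≤ (n : WithBot ℕ∞) + 1 := add_le_add hdim le_rfl
        _ = ((n + 1 : ℕ) : WithBot ℕ∞) := by norm_cast
        _ ≤ ((2 * ringChar (X.residueField (π.base x')) : ℕ) : WithBot ℕ∞) := by exact_mod_cast h2p
  refine h58 X X' π (π.base x') hx hperm hπ x' rfl hchar hC' 0 ?_ ?_ hridge
  · rw [htr, Nat.cast_zero]
  · rw [zero_add]
    exact hH

/-- [OURS · L1 W4.2] **TOP CONFINEMENT, CJS-near form (the DEAL-shaped door, general level).** As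
`isOnProjDirectrix_of_hilbertSamuelFun_eq_top`, with `X` excellent and the near hypothesis in the campaign's idiom
`H^N_{X'}(x') = H^N_X(x)` (`Scheme.hsFun`, any `N ≥ dim X`), converted to Dietel's «(8.2.7.A) is an equality» by the
alignment lemma `NearAlignment` (BY NAME; at the closed point `d = 0`). Modulo F-58♭, F-56, `NearAlignment`.
NOT a statement of the manuscript. [cite: Dietel2015, Main Theorem C p. 130] [cite: CossartJannsenSaito2020, Thm. 3.10 (2)] -/
theorem isOnProjDirectrix_of_near_top (h58 : Dietel2015_mainTheoremC_point_locus.{u})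
    (h56 : Dietel2015_ridge_perfect.{u}) (hAL : NearAlignment.{u}) (hX : Scheme.IsExcellent X)
    (hx : IsClosed ({x} : Set X)) (hπ : IsBlowup π (Scheme.IdealSheafData.vanishingIdeal ⟨{x}, hx⟩)) {n : ℕ}
    (hn : 1 ≤ n) (hdim : topologicalKrullDim X ≤ (n : WithBot ℕ∞))
    (hC : n ≤ 5 ∨ n + 1 ≤ 2 * ringChar (X.residueField x)) (hchar : 0 < ringChar (X.residueField x))
    {N : ℕ} (hN : topologicalKrullDim X ≤ (N : WithBot ℕ∞))
    {x' : X'} (hxx' : π.base x' = x) (hcl : IsClosed ({x'} : Set X'))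
    (htop : Scheme.geomDirDim X x = n) (htop' : n ≤ Scheme.geomDirDim X' x')
    (hnear : Scheme.hsFun X' N x' = Scheme.hsFun X N x) :
    IsOnProjDirectrix π x' := by
  subst hxx'
  haveI : IsProper π := hπ.isProper
  have hē : (n : WithBot ℕ∞) ≤ ringKrullDim (X.presheaf.stalk (π.base x')) := by
    have h := Scheme.natCast_geomDirDim_le_ringKrullDim_stalk (X := X) (π.base x')
    rwa [htop] at h
  have hpos : 0 < ringKrullDim (X.presheaf.stalk (π.base x')) :=
    lt_of_lt_of_le (by exact_mod_cast hn) hē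
  have hperm := isPermissible_vanishingIdeal_singleton_of_ringKrullDim_pos hx hpos
  have hsupp : π.base x' ∈
      ((Scheme.IdealSheafData.vanishingIdeal (⟨{π.base x'}, hx⟩ : Closeds X)).support : Set X) := by
    rw [Scheme.IdealSheafData.coe_support_vanishingIdeal]
    exact Set.mem_singleton _
  obtain ⟨d, hd, hH⟩ := hAL X X' π _ hX hperm hπ N hN x' hsupp hnear
  have htr := trdeg_residueField_eq_zero_of_isClosed π hcl
  rw [htr] at hd
  have hd0 : d = 0 := by exact_mod_cast hd.symm
  subst hd0
  rw [zero_add] at hH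
  exact isOnProjDirectrix_of_hilbertSamuelFun_eq_top h58 h56 hx hπ hn hdim hC hchar rfl hcl htop htop' hH

/-- [OURS · L1 W4.2] **THE W-TOP CONFINEMENT DOOR (D10): on a threefold, a closed near point of the blow-up of a point
with `ē = 3` that keeps `ē = 3` lies on `ℙ(Dir)` — every positive characteristic, every residue field.** `X` excellent,
locally noetherian, `dim X ≤ 3`; `x` closed with `char κ(x) > 0` and `ē_x(X) = 3`; `π : X' → X` the blow-up in `{x}`;
`x'` closed over `x`, near at a level `N ≥ dim X`, with `ē_{x'}(X') ≥ 3`: then `IsOnProjDirectrix π x'`. Modulo, BY NAME: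
F-58♭ `Dietel2015_mainTheoremC_point_locus` (its `dim X ≤ 5` branch — no characteristic condition), F-56
`Dietel2015_ridge_perfect` (ridge = `ē`), `NearAlignment` (CJS 3.10 (2) «⇒», res-L1-type-o1's (AL)). At `p ≥ 3` this is
also CJS Thm. 3.14 (`Thm314_point_locus`, `CharHypothesis` holds); the content is `p = 2`. Consumers: the W-top laws at
`p = 2` (G6 door, C4/T3 dichotomy, D9). NOT a statement of the manuscript.
[cite: Dietel2015, Main Theorem C p. 130] [cite: CossartJannsenSaito2020, Thm. 3.10 (2), Thm. 3.14] -/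
theorem isOnProjDirectrix_of_near_wtop (h58 : Dietel2015_mainTheoremC_point_locus.{u})
    (h56 : Dietel2015_ridge_perfect.{u}) (hAL : NearAlignment.{u}) (hX : Scheme.IsExcellent X)
    (hx : IsClosed ({x} : Set X)) (hπ : IsBlowup π (Scheme.IdealSheafData.vanishingIdeal ⟨{x}, hx⟩))
    (hdim : topologicalKrullDim X ≤ ((3 : ℕ) : WithBot ℕ∞)) (hchar : 0 < ringChar (X.residueField x))
    {N : ℕ} (hN : topologicalKrullDim X ≤ (N : WithBot ℕ∞))
    {x' : X'} (hxx' : π.base x' = x) (hcl : IsClosed ({x'} : Set X'))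
    (htop : Scheme.geomDirDim X x = 3) (htop' : 3 ≤ Scheme.geomDirDim X' x')
    (hnear : Scheme.hsFun X' N x' = Scheme.hsFun X N x) :
    IsOnProjDirectrix π x' :=
  isOnProjDirectrix_of_near_top h58 h56 hAL hX hx hπ (n := 3) (by norm_num) hdim (Or.inl (by norm_num)) hchar hN
    hxx' hcl htop htop' hnear

end Doors

/-! ## 4. The named hypotheses `NearAlignment` (res-L1-type-o1's (AL), p512431) and F-56 (res-lit-4's
`Dietel2015_ridge_perfect_holds`) are now THEOREMS of the tree — the doors modulo F-58♭ alone
(APPEND 2026-08-27, res-L1-w42-plan-1 TAKING TABLE 07:55:06Z «D10 … `nearAlignment_holds` after o1's v2») -/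

section Discharge

/-- [OURS · L1 W4.2] **`NearAlignment` holds**: discharged by res-L1-type-o1's alignment lemma
`CampaignW42.exists_trdeg_hilbertSamuelFun_eq_of_hsFun_eq` (`…CampaignW42NearAlignment.lean`, p512431; fact-free,
every point of the fibre, every characteristic, no level hypothesis), whose hypotheses (`D` permissible at `π x'`,
`𝒪_{X,π x'}` universally catenary) follow from those of `NearAlignment` (`D` permissible, `X` excellent:
`Scheme.IsExcellent.isUniversallyCatenaryRing_stalk`). From here on `(hAL : NearAlignment)` is supplied by this theorem.
[cite: CossartJannsenSaito2020, Thm. 3.10 (2)] -/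
theorem nearAlignment_holds : NearAlignment.{u} := by
  intro X X' _ _ π D hX hD hπ N _ x' hx hnear
  obtain ⟨d, hd, -, hH⟩ := exists_trdeg_hilbertSamuelFun_eq_of_hsFun_eq hπ x' (hD _ hx)
    (hX.isUniversallyCatenaryRing_stalk _) N hnear
  exact ⟨d, hd, hH⟩

variable {X X' : Scheme.{u}} [IsLocallyNoetherian X] [IsLocallyNoetherian X'] {π : X' ⟶ X} {x : X}

/-- **`dim F_x(X) = ē_x(X)` at EVERY point of EVERY locally noetherian scheme, unconditionally**: the ridge dimension
(Giraud's `F_x(X)`, `Scheme.ridgeDim`, the secondary invariant of Cossart–Piltant–Schober) equals the geometric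
directrix dimension (CJS Def. 2.21, `Scheme.geomDirDim`) — `ridgeDim_eq_geomDirDim_of_ridge_perfect` fed with the
tree's discharge `Dietel2015_ridge_perfect_holds` of F-56 (res-lit-4, `RidgePerfectField.lean`: Giraud's structure
theorem, base change of the ridge ideal, `p`-th roots over the perfect field `κ(x)^{alg}`).
[cite: Dietel2015, Lemma (6.3.5) (ii) p. 76; Lemma (6.1.10) p. 72] [cite: CossartJannsenSaito2020, Def. 2.21, Rem. 18.29] -/
theorem ridgeDim_eq_geomDirDim (x : X) : Scheme.ridgeDim X x = Scheme.geomDirDim X x :=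
  ridgeDim_eq_geomDirDim_of_ridge_perfect Dietel2015_ridge_perfect_holds x

/-- [OURS · L1 W4.2] **TOP CONFINEMENT, Dietel-near form, modulo F-58♭ ALONE** (`isOnProjDirectrix_of_hilbertSamuelFun_eq_top`
with F-56 discharged by `Dietel2015_ridge_perfect_holds`). NOT a statement of the manuscript.
[cite: Dietel2015, Main Theorem C p. 130] -/
theorem isOnProjDirectrix_of_hilbertSamuelFun_eq_top' (h58 : Dietel2015_mainTheoremC_point_locus.{u})
    (hx : IsClosed ({x} : Set X)) (hπ : IsBlowup π (Scheme.IdealSheafData.vanishingIdeal ⟨{x}, hx⟩)) {n : ℕ}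
    (hn : 1 ≤ n) (hdim : topologicalKrullDim X ≤ (n : WithBot ℕ∞))
    (hC : n ≤ 5 ∨ n + 1 ≤ 2 * ringChar (X.residueField x)) (hchar : 0 < ringChar (X.residueField x))
    {x' : X'} (hxx' : π.base x' = x) (hcl : IsClosed ({x'} : Set X'))
    (htop : Scheme.geomDirDim X x = n) (htop' : n ≤ Scheme.geomDirDim X' x')
    (hH : hilbertSamuelFun (X'.presheaf.stalk x') 1 = hilbertSamuelFun (X.presheaf.stalk x) 1) :
    IsOnProjDirectrix π x' :=
  isOnProjDirectrix_of_hilbertSamuelFun_eq_top h58 Dietel2015_ridge_perfect_holds hx hπ hn hdim hC hchar hxx' hcl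
    htop htop' hH

/-- [OURS · L1 W4.2] **TOP CONFINEMENT, CJS-near form, modulo F-58♭ ALONE** (`isOnProjDirectrix_of_near_top` with
`NearAlignment` discharged by `nearAlignment_holds` and F-56 by `Dietel2015_ridge_perfect_holds`). NOT a statement
of the manuscript. [cite: Dietel2015, Main Theorem C p. 130] [cite: CossartJannsenSaito2020, Thm. 3.10 (2)] -/
theorem isOnProjDirectrix_of_near_top' (h58 : Dietel2015_mainTheoremC_point_locus.{u}) (hX : Scheme.IsExcellent X)
    (hx : IsClosed ({x} : Set X)) (hπ : IsBlowup π (Scheme.IdealSheafData.vanishingIdeal ⟨{x}, hx⟩)) {n : ℕ}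
    (hn : 1 ≤ n) (hdim : topologicalKrullDim X ≤ (n : WithBot ℕ∞))
    (hC : n ≤ 5 ∨ n + 1 ≤ 2 * ringChar (X.residueField x)) (hchar : 0 < ringChar (X.residueField x))
    {N : ℕ} (hN : topologicalKrullDim X ≤ (N : WithBot ℕ∞))
    {x' : X'} (hxx' : π.base x' = x) (hcl : IsClosed ({x'} : Set X'))
    (htop : Scheme.geomDirDim X x = n) (htop' : n ≤ Scheme.geomDirDim X' x')
    (hnear : Scheme.hsFun X' N x' = Scheme.hsFun X N x) :
    IsOnProjDirectrix π x' :=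
  isOnProjDirectrix_of_near_top h58 Dietel2015_ridge_perfect_holds nearAlignment_holds hX hx hπ hn hdim hC hchar hN
    hxx' hcl htop htop' hnear

/-- [OURS · L1 W4.2] **THE W-TOP CONFINEMENT DOOR MODULO F-58♭ ALONE** (`isOnProjDirectrix_of_near_wtop` with
`NearAlignment` and F-56 discharged): on an excellent threefold (`dim X ≤ 3`), a CLOSED near point `x'` (any level
`N ≥ dim X`) of the blow-up of a closed point `x` with `char κ(x) > 0` and `ē_x(X) = 3` which keeps `ē_{x'}(X') ≥ 3`
lies on `ℙ(Dir_x(X))` — every `p > 0`, every residue field; the ONLY remaining named input is Dietel's Main Theorem C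
for point centres (`Dietel2015_mainTheoremC_point_locus`, THESIS-flagged; its proof rests on Oda's classification of
Hironaka schemes and [H4] Th. IV). NOT a statement of the manuscript. [cite: Dietel2015, Main Theorem C p. 130] -/
theorem isOnProjDirectrix_of_near_wtop' (h58 : Dietel2015_mainTheoremC_point_locus.{u}) (hX : Scheme.IsExcellent X)
    (hx : IsClosed ({x} : Set X)) (hπ : IsBlowup π (Scheme.IdealSheafData.vanishingIdeal ⟨{x}, hx⟩))
    (hdim : topologicalKrullDim X ≤ ((3 : ℕ) : WithBot ℕ∞)) (hchar : 0 < ringChar (X.residueField x))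
    {N : ℕ} (hN : topologicalKrullDim X ≤ (N : WithBot ℕ∞))
    {x' : X'} (hxx' : π.base x' = x) (hcl : IsClosed ({x'} : Set X'))
    (htop : Scheme.geomDirDim X x = 3) (htop' : 3 ≤ Scheme.geomDirDim X' x')
    (hnear : Scheme.hsFun X' N x' = Scheme.hsFun X N x) :
    IsOnProjDirectrix π x' :=
  isOnProjDirectrix_of_near_wtop h58 Dietel2015_ridge_perfect_holds nearAlignment_holds hX hx hπ hdim hchar hN hxx'
    hcl htop htop' hnear

end Discharge

end CampaignW42

end Summit.ResolutionOfSingularities.ResolutionOfSingularities.Theorems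

end
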